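import Literature.Algebra.EuclideanLattices.MRThm59Attempt
import HarnessLib

/-!
# MR07 Thm. 5.9: a sharp grid and width for the attempt (quality `(5/4)·β√n` instead of `3(⌊β⌋+1)n`)

Topic `Algebra/EuclideanLattices` (family `pqc`). `MRThm59Attempt.lean` runs one attempt of Micciancio–Regev's
Thm. 5.9 on the fine grid `N = N₁|α|t_d` with `N₁ = q 2^{e(n)} r_d βup n` and the power-of-two width
`s = 2^{⌊log₂ X⌋}√π/N`, which pins `s` only within a factor `2` of `2c r/(βup n)`; the promise it needs is then
`r > 3(⌊β⌋+1) n · η`. The decider of Thm. 5.23 (`MRGapCVPAssembly.lean`) needs the solver's quality inside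
`(5/4)·β√n` (the verifier's window). This file supplies a sharper, still exactly computable, choice of the grid
and of the width for the SAME attempt (`toReal_naturalAttemptWith_goodAnswers_ge` is generic in `N₁`, `s`):

* `sqrtUp n = ⌊√(10⁴ n)⌋ + 1` (`√n ≤ sqrtUp n/100 ≤ √n + 1/100`);
* the target `s₁ = 200 c r_n β_den/(r_d β_num sqrtUp n)` (`s₁ ≤ 2c r/(β√n) ≤ 1.01 s₁`), written with naturals
  `AOf = 20000 c r_n β_den |α| t_d` and `BdOf = r_d β_num sqrtUp n` (`100 s₁ |α| t_d = AOf/BdOf`);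
* the mesh exponent `bSharp = size ((AOf/BdOf + 1)(q n 2ⁿ + 1))`, the grid
  `N1Sharp = ⌊2ᵇ · 17725 · BdOf/(2·10⁶ c r_n β_den |α| t_d)⌋ + 1` (so `N1Sharp ≈ 2ᵇ πU/(s₁|α|t_d)`, `πU = 1.7725 ≥ √π`)
  and the width `sSharp = 2ᵇ√π/N`, `N = NOf J α N1Sharp`;
* **`sSharp_hi`** — `s β√n/2 ≤ c r`; **`sSharp_lo`** — `2cη_{2⁻ⁿ}(L(U)) ≤ s` under the promise
  `r > (5/4)β√n · η_{2⁻ⁿ}(L(U))`; `q_le_NOf_sharp`, `slackN_le_sharp` (`q ≤ N`, `n q/N ≤ 2⁻ⁿ`), `NOf_mul_sSharp`.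

All proved; definitions with bodies; no named fact.

## References

* D. Micciancio, O. Regev, *Worst-case to average-case reductions based on Gaussian measures*, SIAM J. Comput.
  37 (2007) 267–302; authors' version, Thm. 5.9 (step 2: `s = 2r/γ`, the grid `L(B*)/N`), Thm. 5.23 (proof,
  p. 30: the solver is used with `γ(n) = β(n)√n`).
-/

noncomputable section

open scoped Classical Real

namespace Literature.Algebra.EuclideanLattices

namespace MRThm59

open Literature.Probability.Distributions MRLemma510 DualGrid GSInverse

variable (J : IncGDDInst)

/-! ### A rational upper bound of `√n` -/

/-- `sqrtUp n = ⌊√(10⁴ n)⌋ + 1`: `√n ≤ sqrtUp n/100 ≤ √n + 1/100`. [folklore] -/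
def sqrtUp (n : ℕ) : ℕ := Nat.sqrt (10000 * n) + 1

/-- `√n < sqrtUp n / 100`. [folklore] -/
theorem sqrt_lt_sqrtUp (n : ℕ) : Real.sqrt n < (sqrtUp n : ℝ) / 100 := by
  rw [lt_div_iff₀ (by norm_num), sqrtUp]
  have h := Nat.lt_succ_sqrt' (10000 * n)
  have h' : ((10000 * n : ℕ) : ℝ) < (((Nat.sqrt (10000 * n) + 1) ^ 2 : ℕ) : ℝ) := by exact_mod_cast h
  have hs : Real.sqrt n * 100 = Real.sqrt ((10000 * n : ℕ) : ℝ) := by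
    rw [show ((10000 * n : ℕ) : ℝ) = (100 : ℝ) ^ 2 * n by push_cast; ring, Real.sqrt_mul (by positivity), Real.sqrt_sq (by norm_num)]
    ring
  rw [hs, Real.sqrt_lt' (by positivity)]
  exact_mod_cast h

/-- `sqrtUp n / 100 ≤ √n + 1/100`. [folklore] -/
theorem sqrtUp_le (n : ℕ) : (sqrtUp n : ℝ) / 100 ≤ Real.sqrt n + 1 / 100 := by
  rw [div_le_iff₀ (by norm_num), sqrtUp]
  have h := Nat.sqrt_le' (10000 * n)
  have h' : (((Nat.sqrt (10000 * n)) ^ 2 : ℕ) : ℝ) ≤ ((10000 * n : ℕ) : ℝ) := by exact_mod_cast h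
  have hle : (Nat.sqrt (10000 * n) : ℝ) ≤ Real.sqrt n * 100 := by
    have h0 : (0 : ℝ) ≤ Nat.sqrt (10000 * n) := Nat.cast_nonneg _
    rw [← Real.sqrt_sq h0]
    calc Real.sqrt ((Nat.sqrt (10000 * n) : ℝ) ^ 2) ≤ Real.sqrt ((100 : ℝ) ^ 2 * n) := Real.sqrt_le_sqrt (by push_cast at h' ⊢; linarith)
      _ = Real.sqrt n * 100 := by rw [Real.sqrt_mul (by positivity), Real.sqrt_sq (by norm_num)]; ring
  push_cast
  linarith

/-- `1 ≤ sqrtUp n`. [folklore] -/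
theorem one_le_sqrtUp (n : ℕ) : 1 ≤ sqrtUp n := Nat.le_add_left _ _

/-! ### The sharp grid and width -/

/-- `A = 20000 · c · r_n · β_den · |α| · t_d` (`= 100 s₁ |α| t_d · Bd`). [folklore] -/
def AOf (βden : ℕ) (α : ℤ) : ℕ := 20000 * (cU (Umat J)).toNat * J.rn * βden * α.natAbs * J.td

/-- `Bd = r_d · β_num · sqrtUp n`. [folklore] -/
def BdOf (βnum : ℕ) : ℕ := J.rd * βnum * sqrtUp J.n

/-- **The mesh exponent `b = size ((A/Bd + 1)(q n 2ⁿ + 1)) + (rOf n + 3)`** (the last summand only makes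
`b ≥ e(n) = n + rOf n + 3`, room for the sampler's precision). [cite: MicciancioRegev2007, Thm. 5.9 (step 2) — machine choice] -/
def bSharp (q βnum βden : ℕ) (α : ℤ) : ℕ := Nat.size ((AOf J βden α / BdOf J βnum + 1) * (q * J.n * 2 ^ J.n + 1)) + (PGParams.rOf J.n + 3)

/-- **The grid multiplier `N₁ = ⌊2ᵇ · 17725 · Bd/(2·10⁶ c r_n β_den |α| t_d)⌋ + 1`.** [cite: MicciancioRegev2007, Thm. 5.9 (step 2) — machine choice] -/
def N1Sharp (q βnum βden : ℕ) (α : ℤ) : ℕ :=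
  (2 ^ bSharp J q βnum βden α * 17725 * BdOf J βnum) / (2000000 * (cU (Umat J)).toNat * J.rn * βden * α.natAbs * J.td) + 1

/-- **The width `s = 2ᵇ√π/N`**, `N = NOf J α N₁`. [cite: MicciancioRegev2007, Thm. 5.9 (step 2)] -/
def sSharp (q βnum βden : ℕ) (α : ℤ) : ℝ := (2 : ℝ) ^ bSharp J q βnum βden α * √π / (NOf J α (N1Sharp J q βnum βden α) : ℝ)

variable {J}

/-! ### The casts -/

/-- `c = cU` as a real. [folklore] -/
theorem cast_cU_toNat (hJ : J.WellFormed) : (((cU (Umat J)).toNat : ℕ) : ℝ) = cU (Umat J) := by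
  have := Int.toNat_of_nonneg (cU_pos (det_Umat_ne hJ)).le
  exact_mod_cast this

/-- `0 < N₁`. [folklore] -/
theorem N1Sharp_pos (q βnum βden : ℕ) (α : ℤ) : 0 < N1Sharp J q βnum βden α := Nat.succ_pos _

/-- `0 < Bd`. [folklore] -/
theorem BdOf_pos (hJ : J.WellFormed) {βnum : ℕ} (hβnum : 1 ≤ βnum) : 0 < BdOf J βnum :=
  Nat.mul_pos (Nat.mul_pos hJ.rd_pos (by omega)) (one_le_sqrtUp _)

/-- The real `y = 2ᵇ · 17725 · Bd/(2·10⁶ c r_n β_den |α| t_d)` behind `N₁ = ⌊y⌋ + 1`. [folklore] -/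
def ySharp (J : IncGDDInst) (q βnum βden : ℕ) (α : ℤ) : ℝ :=
  ((2 ^ bSharp J q βnum βden α * 17725 * BdOf J βnum : ℕ) : ℝ) / ((2000000 * (cU (Umat J)).toNat * J.rn * βden * α.natAbs * J.td : ℕ) : ℝ)

/-- `N₁ = ⌊y⌋ + 1`. [folklore] -/
theorem N1Sharp_eq (q βnum βden : ℕ) (α : ℤ) : N1Sharp J q βnum βden α = ⌊ySharp J q βnum βden α⌋₊ + 1 := by
  rw [N1Sharp, ySharp, Nat.floor_div_eq_div]

/-- `y < N₁ ≤ y + 1`. [folklore] -/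
theorem ySharp_lt_N1Sharp (q βnum βden : ℕ) (α : ℤ) :
    ySharp J q βnum βden α < (N1Sharp J q βnum βden α : ℝ) ∧ (N1Sharp J q βnum βden α : ℝ) ≤ ySharp J q βnum βden α + 1 := by
  have hy0 : 0 ≤ ySharp J q βnum βden α := by unfold ySharp; positivity
  rw [N1Sharp_eq]; push_cast
  exact ⟨Nat.lt_floor_add_one _, by have := Nat.floor_le hy0; linarith⟩

/-- `2ᵇ > (A/Bd + 1)·(q n 2ⁿ + 1)`. [folklore] -/
theorem two_pow_bSharp_gt (q βnum βden : ℕ) (α : ℤ) :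
    ((AOf J βden α / BdOf J βnum + 1) * (q * J.n * 2 ^ J.n + 1) : ℕ) < 2 ^ bSharp J q βnum βden α := by
  have h := Nat.lt_size_self ((AOf J βden α / BdOf J βnum + 1) * (q * J.n * 2 ^ J.n + 1))
  exact lt_of_lt_of_le h (Nat.pow_le_pow_right (by norm_num) (Nat.le_add_right _ _))

/-- **`e(n) ≤ b`** for `q, n ≥ 1` (room for the sampler's precision, as `le_bOf`). [folklore] -/
theorem le_bSharp {q : ℕ} (hq : 0 < q) (hn : 1 ≤ J.n) (βnum βden : ℕ) (α : ℤ) : eOf J.n ≤ bSharp J q βnum βden α := by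
  -- `2ⁿ ≤ (A/Bd + 1)(q n 2ⁿ + 1)`, so `n + 1 ≤ size (…)`
  have h1 : 2 ^ J.n < (AOf J βden α / BdOf J βnum + 1) * (q * J.n * 2 ^ J.n + 1) := by
    have h2 : 2 ^ J.n ≤ q * J.n * 2 ^ J.n := Nat.le_mul_of_pos_left _ (Nat.mul_pos hq (by omega))
    have h3 : q * J.n * 2 ^ J.n + 1 ≤ (AOf J βden α / BdOf J βnum + 1) * (q * J.n * 2 ^ J.n + 1) := Nat.le_mul_of_pos_left _ (Nat.succ_pos _)
    omega
  have h4 : J.n < Nat.size ((AOf J βden α / BdOf J βnum + 1) * (q * J.n * 2 ^ J.n + 1)) := Nat.lt_size.2 h1.le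
  rw [eOf, bSharp]; omega

/-- The target `s₁ = 200 c r_n β_den/(r_d β_num sqrtUp n)` is positive. [folklore] -/
theorem s1_pos (hJ : J.WellFormed) {βnum βden : ℕ} (hβnum : 1 ≤ βnum) (hβden : 1 ≤ βden) (hrn : 1 ≤ J.rn) :
    0 < 200 * (cU (Umat J) : ℝ) * J.rn * βden / ((J.rd : ℝ) * βnum * sqrtUp J.n) := by
  have := cR_pos hJ; have : (0 : ℝ) < J.rd := by exact_mod_cast hJ.rd_pos
  have : (0 : ℝ) < J.rn := by exact_mod_cast hrn
  have : (0 : ℝ) < sqrtUp J.n := by exact_mod_cast one_le_sqrtUp J.n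
  have : (0 : ℝ) < βnum := by exact_mod_cast hβnum
  have : (0 : ℝ) < βden := by exact_mod_cast hβden
  positivity

/-- `y = 2ᵇ · 1.7725/(s₁ · |α| t_d)` and `100 s₁ |α| t_d < A/Bd + 1` (reals versus naturals). [folklore] -/
theorem ySharp_eq_and_lt (hJ : J.WellFormed) {q βnum βden : ℕ} (hβnum : 1 ≤ βnum) (hβden : 1 ≤ βden) {α : ℤ} (hα : α ≠ 0) (hrn : 1 ≤ J.rn) :
    ySharp J q βnum βden α = (2 : ℝ) ^ bSharp J q βnum βden α * (17725 / 10000) /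
      (200 * (cU (Umat J) : ℝ) * J.rn * βden / ((J.rd : ℝ) * βnum * sqrtUp J.n) * ((α.natAbs : ℝ) * J.td)) ∧
    100 * (200 * (cU (Umat J) : ℝ) * J.rn * βden / ((J.rd : ℝ) * βnum * sqrtUp J.n)) * ((α.natAbs : ℝ) * J.td) <
      ((AOf J βden α / BdOf J βnum + 1 : ℕ) : ℝ) := by
  have hc := cR_pos hJ
  have hcN := cast_cU_toNat hJ
  have hrn' : (0 : ℝ) < J.rn := by exact_mod_cast hrn
  have hβd : (0 : ℝ) < βden := by exact_mod_cast hβden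
  have hβn : (0 : ℝ) < βnum := by exact_mod_cast hβnum
  have hrd : (0 : ℝ) < J.rd := by exact_mod_cast hJ.rd_pos
  have htd : (0 : ℝ) < J.td := by exact_mod_cast hJ.td_pos
  have hαr : (0 : ℝ) < (α.natAbs : ℝ) := by exact_mod_cast Int.natAbs_pos.2 hα
  have hsq : (0 : ℝ) < sqrtUp J.n := by exact_mod_cast one_le_sqrtUp J.n
  constructor
  · rw [ySharp, BdOf]; push_cast; rw [hcN]; field_simp; ring
  · have hBd0 : 0 < BdOf J βnum := BdOf_pos hJ hβnum
    have hB : (0 : ℝ) < (BdOf J βnum : ℝ) := by exact_mod_cast hBd0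
    have hlt := Nat.lt_div_mul_add (a := AOf J βden α) hBd0
    have h' : ((AOf J βden α : ℕ) : ℝ) < ((AOf J βden α / BdOf J βnum + 1 : ℕ) : ℝ) * (BdOf J βnum : ℝ) := by
      have : ((AOf J βden α : ℕ) : ℝ) < (((AOf J βden α / BdOf J βnum) * BdOf J βnum + BdOf J βnum : ℕ) : ℝ) := by exact_mod_cast hlt
      push_cast at this ⊢; linarith
    have hAB : 100 * (200 * (cU (Umat J) : ℝ) * J.rn * βden / ((J.rd : ℝ) * βnum * sqrtUp J.n)) * ((α.natAbs : ℝ) * J.td) * (BdOf J βnum : ℝ) =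
        ((AOf J βden α : ℕ) : ℝ) := by
      rw [AOf, BdOf]; push_cast; rw [hcN]; field_simp; ring
    rw [← hAB] at h'
    exact lt_of_mul_lt_mul_right h' hB.le

/-! ### The window of the width -/

/-- **Upper bound: `s < s₁`**, `s₁ = 200 c r_n β_den/(r_d β_num sqrtUp n)` (`√π < 1.7725`). [cite: MicciancioRegev2007, Thm. 5.9 (step 2)] -/
theorem sSharp_lt_s1 (hJ : J.WellFormed) {q βnum βden : ℕ} (hβnum : 1 ≤ βnum) (hβden : 1 ≤ βden) {α : ℤ} (hα : α ≠ 0) (hrn : 1 ≤ J.rn) :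
    sSharp J q βnum βden α < 200 * (cU (Umat J) : ℝ) * J.rn * βden / ((J.rd : ℝ) * βnum * sqrtUp J.n) := by
  have hc := cR_pos hJ
  have hrd : (0 : ℝ) < J.rd := by exact_mod_cast hJ.rd_pos
  have hsq : (0 : ℝ) < sqrtUp J.n := by exact_mod_cast one_le_sqrtUp J.n
  have hβn : (0 : ℝ) < βnum := by exact_mod_cast hβnum
  have hβd : (0 : ℝ) < βden := by exact_mod_cast hβden
  have hrn' : (0 : ℝ) < J.rn := by exact_mod_cast hrn
  have htd : (0 : ℝ) < J.td := by exact_mod_cast hJ.td_pos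
  have hαr : (0 : ℝ) < (α.natAbs : ℝ) := by exact_mod_cast Int.natAbs_pos.2 hα
  have hpiU : √π < 1.7725 := by
    rw [Real.sqrt_lt' (by norm_num)]; have := Real.pi_lt_d4; nlinarith
  have hs₁ := s1_pos hJ hβnum hβden hrn
  set s₁ : ℝ := 200 * (cU (Umat J) : ℝ) * J.rn * βden / ((J.rd : ℝ) * βnum * sqrtUp J.n) with hs₁def
  set M : ℝ := (α.natAbs : ℝ) * J.td with hM
  have hM0 : 0 < M := by rw [hM]; positivity
  obtain ⟨hy, -⟩ := ySharp_eq_and_lt hJ hβnum hβden hα hrn (q := q)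
  have hN1 := (ySharp_lt_N1Sharp (J := J) q βnum βden α).1
  have hNcast : ((NOf J α (N1Sharp J q βnum βden α) : ℕ) : ℝ) = (N1Sharp J q βnum βden α : ℝ) * M := by
    rw [NOf, hM]; push_cast; ring
  have hN0 : (0 : ℝ) < ((NOf J α (N1Sharp J q βnum βden α) : ℕ) : ℝ) := by exact_mod_cast NOf_pos hJ hα (N1Sharp_pos q βnum βden α)
  rw [sSharp, div_lt_iff₀ hN0, hNcast]
  -- `2ᵇ√π < 2ᵇ · 1.7725 = s₁ · (y M) < s₁ · (N₁ M)`
  have hyM : s₁ * (ySharp J q βnum βden α * M) = (2 : ℝ) ^ bSharp J q βnum βden α * (17725 / 10000) := by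
    rw [hy, hs₁def, hM]; field_simp
  calc (2 : ℝ) ^ bSharp J q βnum βden α * √π < (2 : ℝ) ^ bSharp J q βnum βden α * (17725 / 10000) :=
        mul_lt_mul_of_pos_left (by linarith) (by positivity)
    _ = s₁ * (ySharp J q βnum βden α * M) := hyM.symm
    _ < s₁ * ((N1Sharp J q βnum βden α : ℝ) * M) := by
        exact mul_lt_mul_of_pos_left (mul_lt_mul_of_pos_right hN1 hM0) hs₁

/-- **`s₁ ≤ 2 c r/(β√n)`** (`sqrtUp n/100 ≥ √n`). [folklore] -/
theorem s1_le_target (hJ : J.WellFormed) {βnum βden : ℕ} (hβnum : 1 ≤ βnum) (hβden : 1 ≤ βden) (hrn : 1 ≤ J.rn) :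
    200 * (cU (Umat J) : ℝ) * J.rn * βden / ((J.rd : ℝ) * βnum * sqrtUp J.n) ≤
      2 * (cU (Umat J) : ℝ) * J.radius / (((βnum : ℝ) / βden) * Real.sqrt J.n) := by
  have hc := cR_pos hJ
  have hrn' : (0 : ℝ) < J.rn := by exact_mod_cast hrn
  have hβd : (0 : ℝ) < βden := by exact_mod_cast hβden
  have hβn : (0 : ℝ) < βnum := by exact_mod_cast hβnum
  have hrd : (0 : ℝ) < J.rd := by exact_mod_cast hJ.rd_pos
  have hn : (0 : ℝ) < J.n := by exact_mod_cast hJ.one_le_n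
  have hsn : 0 < Real.sqrt J.n := Real.sqrt_pos.2 hn
  have hsq : (0 : ℝ) < sqrtUp J.n := by exact_mod_cast one_le_sqrtUp J.n
  have hup := sqrt_lt_sqrtUp J.n
  rw [IncGDDInst.radius, div_le_div_iff₀ (by positivity) (by positivity)]
  have e1 : 200 * (cU (Umat J) : ℝ) * J.rn * βden * (((βnum : ℝ) / βden) * Real.sqrt J.n) = 2 * (cU (Umat J) : ℝ) * J.rn * βnum * (100 * Real.sqrt J.n) := by
    field_simp; ring
  have e2 : 2 * (cU (Umat J) : ℝ) * ((J.rn : ℝ) / J.rd) * ((J.rd : ℝ) * βnum * sqrtUp J.n) = 2 * (cU (Umat J) : ℝ) * J.rn * βnum * sqrtUp J.n := by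
    field_simp
  rw [e1, e2]
  refine mul_le_mul_of_nonneg_left ?_ (by positivity)
  rw [lt_div_iff₀ (by norm_num)] at hup
  linarith

/-- **Lower bound: `s > √π s₁/(1.7725 + 1/100)`** (so `s > 0.994 s₁`). [cite: MicciancioRegev2007, Thm. 5.9 (step 2)] -/
theorem lt_sSharp (hJ : J.WellFormed) {q βnum βden : ℕ} (hβnum : 1 ≤ βnum) (hβden : 1 ≤ βden) {α : ℤ} (hα : α ≠ 0) (hrn : 1 ≤ J.rn) :
    √π / (1.7725 + 1 / 100) * (200 * (cU (Umat J) : ℝ) * J.rn * βden / ((J.rd : ℝ) * βnum * sqrtUp J.n)) <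
      sSharp J q βnum βden α := by
  have hc := cR_pos hJ
  have hrd : (0 : ℝ) < J.rd := by exact_mod_cast hJ.rd_pos
  have hsq : (0 : ℝ) < sqrtUp J.n := by exact_mod_cast one_le_sqrtUp J.n
  have hβn : (0 : ℝ) < βnum := by exact_mod_cast hβnum
  have hβd : (0 : ℝ) < βden := by exact_mod_cast hβden
  have hrn' : (0 : ℝ) < J.rn := by exact_mod_cast hrn
  have htd : (0 : ℝ) < J.td := by exact_mod_cast hJ.td_pos
  have hαr : (0 : ℝ) < (α.natAbs : ℝ) := by exact_mod_cast Int.natAbs_pos.2 hα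
  have hpi0 : 0 < √π := Real.sqrt_pos.2 Real.pi_pos
  have hs₁ := s1_pos hJ hβnum hβden hrn
  set s₁ : ℝ := 200 * (cU (Umat J) : ℝ) * J.rn * βden / ((J.rd : ℝ) * βnum * sqrtUp J.n) with hs₁def
  set M : ℝ := (α.natAbs : ℝ) * J.td with hM
  have hM0 : 0 < M := by rw [hM]; positivity
  obtain ⟨hy, hAB⟩ := ySharp_eq_and_lt hJ hβnum hβden hα hrn (q := q)
  have hN1 := (ySharp_lt_N1Sharp (J := J) q βnum βden α).2
  -- `2ᵇ > 100 s₁ M`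
  have h2b : 100 * s₁ * M < (2 : ℝ) ^ bSharp J q βnum βden α := by
    have hlt : ((((AOf J βden α / BdOf J βnum + 1) * (q * J.n * 2 ^ J.n + 1) : ℕ)) : ℝ) < (2 : ℝ) ^ bSharp J q βnum βden α := by
      exact_mod_cast two_pow_bSharp_gt (J := J) q βnum βden α
    have hge : ((AOf J βden α / BdOf J βnum + 1 : ℕ) : ℝ) ≤ (((AOf J βden α / BdOf J βnum + 1) * (q * J.n * 2 ^ J.n + 1) : ℕ) : ℝ) := by
      exact_mod_cast Nat.le_mul_of_pos_right _ (Nat.succ_pos _)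
    linarith
  have hNcast : ((NOf J α (N1Sharp J q βnum βden α) : ℕ) : ℝ) = (N1Sharp J q βnum βden α : ℝ) * M := by
    rw [NOf, hM]; push_cast; ring
  have hN0 : (0 : ℝ) < ((NOf J α (N1Sharp J q βnum βden α) : ℕ) : ℝ) := by exact_mod_cast NOf_pos hJ hα (N1Sharp_pos q βnum βden α)
  rw [sSharp, lt_div_iff₀ hN0, hNcast]
  have hyM : ySharp J q βnum βden α * M = (2 : ℝ) ^ bSharp J q βnum βden α * (17725 / 10000) / s₁ := by
    rw [hy, hs₁def, hM]; field_simp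
  calc √π / (1.7725 + 1 / 100) * s₁ * ((N1Sharp J q βnum βden α : ℝ) * M)
      ≤ √π / (1.7725 + 1 / 100) * s₁ * ((ySharp J q βnum βden α + 1) * M) := by gcongr
    _ = √π * (((2 : ℝ) ^ bSharp J q βnum βden α * (17725 / 10000) + s₁ * M) / (1.7725 + 1 / 100)) := by
        rw [add_mul, hyM]; field_simp
    _ < √π * (2 : ℝ) ^ bSharp J q βnum βden α := by
        refine mul_lt_mul_of_pos_left ?_ hpi0
        rw [div_lt_iff₀ (by norm_num)]
        nlinarith
    _ = (2 : ℝ) ^ bSharp J q βnum βden α * √π := mul_comm _ _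

/-- `0 < s`. [folklore] -/
theorem sSharp_pos (hJ : J.WellFormed) {q βnum βden : ℕ} (hβnum : 1 ≤ βnum) (hβden : 1 ≤ βden) {α : ℤ} (hα : α ≠ 0) (hrn : 1 ≤ J.rn) :
    0 < sSharp J q βnum βden α := by
  refine lt_trans ?_ (lt_sSharp hJ hβnum hβden hα hrn)
  have := s1_pos hJ hβnum hβden hrn
  have : 0 < √π := Real.sqrt_pos.2 Real.pi_pos
  positivity

/-- **`hs_hi`: `s β√n/2 ≤ c r`** for `β = β_num/β_den`. [cite: MicciancioRegev2007, Thm. 5.9 (s = 2r/γ, γ = β√n)] -/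
theorem sSharp_hi (hJ : J.WellFormed) {q βnum βden : ℕ} (hβnum : 1 ≤ βnum) (hβden : 1 ≤ βden) {α : ℤ} (hα : α ≠ 0) (hrn : 1 ≤ J.rn) :
    sSharp J q βnum βden α * ((βnum : ℝ) / βden) * Real.sqrt J.n / 2 ≤ cU (Umat J) * J.radius := by
  have hs := (sSharp_lt_s1 hJ hβnum hβden hα hrn (q := q)).le.trans (s1_le_target hJ hβnum hβden hrn)
  have hβ : (0 : ℝ) < (βnum : ℝ) / βden := by
    have : (0 : ℝ) < βnum := by exact_mod_cast hβnum
    have : (0 : ℝ) < βden := by exact_mod_cast hβden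
    positivity
  have hn : (0 : ℝ) < Real.sqrt J.n := Real.sqrt_pos.2 (by exact_mod_cast hJ.one_le_n)
  rw [le_div_iff₀ (by positivity)] at hs
  linarith

/-- **`hs_lo` from the sharp promise**: if `r > (5/4)β√n · η_{2⁻ⁿ}(L(U))` then `2c·η_{2⁻ⁿ}(L(U)) ≤ s`
(`s > 0.984 · 2cr/(β√n) > 0.984 · (5/2) c η`). [cite: MicciancioRegev2007, Thm. 5.9 (r > γ φ(B) gives s ≥ 2η); Thm. 5.23 (γ = β√n)] -/
theorem sSharp_lo (hJ : J.WellFormed) {q βnum βden : ℕ} (hβnum : 1 ≤ βnum) (hβden : 1 ≤ βden) {α : ℤ} (hα : α ≠ 0) (hrn : 1 ≤ J.rn)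
    (hprom : J.Promise (5 / 4 * ((βnum : ℝ) / βden) * Real.sqrt J.n)) :
    2 * ((cU (Umat J) : ℝ) * smoothingParameter J.lattice ((2⁻¹ : ℝ) ^ J.n)) ≤ sSharp J q βnum βden α := by
  have hlt := lt_sSharp hJ hβnum hβden hα hrn (q := q)
  have hc := cR_pos hJ
  have hη := smoothingParameter_nonneg J.lattice ((2⁻¹ : ℝ) ^ J.n)
  have hβn : (0 : ℝ) < βnum := by exact_mod_cast hβnum
  have hβd : (0 : ℝ) < βden := by exact_mod_cast hβden
  have hrd : (0 : ℝ) < J.rd := by exact_mod_cast hJ.rd_pos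
  have hrn' : (0 : ℝ) < J.rn := by exact_mod_cast hrn
  have hn : (0 : ℝ) < J.n := by exact_mod_cast hJ.one_le_n
  have hsn : 0 < Real.sqrt J.n := Real.sqrt_pos.2 hn
  have hsq0 : (0 : ℝ) < sqrtUp J.n := by exact_mod_cast one_le_sqrtUp J.n
  obtain ⟨hpi1, -⟩ := sqrt_pi_bounds'
  have hup := sqrtUp_le J.n
  rw [IncGDDInst.Promise, IncGDDInst.radius] at hprom
  refine le_trans ?_ hlt.le
  set η := smoothingParameter J.lattice ((2⁻¹ : ℝ) ^ J.n) with hηdef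
  have h1 : 5 / 4 * ((βnum : ℝ) / βden) * Real.sqrt J.n * η < (J.rn : ℝ) / J.rd := hprom
  -- `sqrtUp ≤ 101 √n`
  have hsq1 : (sqrtUp J.n : ℝ) ≤ 101 * Real.sqrt J.n := by
    have h1' : (1 : ℝ) ≤ Real.sqrt J.n := by
      rw [Real.le_sqrt (by norm_num) hn.le]; exact_mod_cast hJ.one_le_n
    rw [div_le_iff₀ (by norm_num)] at hup
    linarith
  -- `2η · rd βnum sqrtUp ≤ (8/5)·101 · rn βden`
  have hηb : 2 * η * ((J.rd : ℝ) * βnum * sqrtUp J.n) ≤ (8 / 5 * 101) * ((J.rn : ℝ) * βden) := by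
    have h2 : ((βnum : ℝ) / βden) * Real.sqrt J.n * η * (J.rd : ℝ) < (J.rn : ℝ) * (4 / 5) := by
      rw [lt_div_iff₀ hrd] at h1; linarith
    have h3 : (βnum : ℝ) * Real.sqrt J.n * η * J.rd < (4 / 5) * J.rn * βden := by
      have := mul_lt_mul_of_pos_right h2 hβd
      have e : ((βnum : ℝ) / βden) * Real.sqrt J.n * η * (J.rd : ℝ) * βden = (βnum : ℝ) * Real.sqrt J.n * η * J.rd := by field_simp
      linarith
    have hη2 : 0 ≤ 2 * η * ((J.rd : ℝ) * βnum) := by positivity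
    calc 2 * η * ((J.rd : ℝ) * βnum * sqrtUp J.n) = 2 * η * ((J.rd : ℝ) * βnum) * sqrtUp J.n := by ring
      _ ≤ 2 * η * ((J.rd : ℝ) * βnum) * (101 * Real.sqrt J.n) := mul_le_mul_of_nonneg_left hsq1 hη2
      _ = 2 * 101 * ((βnum : ℝ) * Real.sqrt J.n * η * J.rd) := by ring
      _ ≤ 2 * 101 * ((4 / 5) * J.rn * βden) := by linarith
      _ = (8 / 5 * 101) * ((J.rn : ℝ) * βden) := by ring
  -- `(8/5)·101 ≤ (√π/1.7825)·200`
  have hcoef : (8 / 5 * 101 : ℝ) ≤ √π / (1.7725 + 1 / 100) * 200 := by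
    have h1 : (1.7 : ℝ) / (1.7725 + 1 / 100) * 200 ≤ √π / (1.7725 + 1 / 100) * 200 := by gcongr
    have h2 : (8 / 5 * 101 : ℝ) ≤ 1.7 / (1.7725 + 1 / 100) * 200 := by norm_num
    linarith
  have hK : 2 * η ≤ √π / (1.7725 + 1 / 100) * (200 * (J.rn : ℝ) * βden / ((J.rd : ℝ) * βnum * sqrtUp J.n)) := by
    rw [mul_div_assoc', le_div_iff₀ (by positivity)]
    calc 2 * η * ((J.rd : ℝ) * βnum * sqrtUp J.n) ≤ (8 / 5 * 101) * ((J.rn : ℝ) * βden) := hηb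
      _ ≤ (√π / (1.7725 + 1 / 100) * 200) * ((J.rn : ℝ) * βden) := mul_le_mul_of_nonneg_right hcoef (by positivity)
      _ = √π / (1.7725 + 1 / 100) * (200 * (J.rn : ℝ) * βden) := by ring
  calc 2 * ((cU (Umat J) : ℝ) * η) = (cU (Umat J) : ℝ) * (2 * η) := by ring
    _ ≤ (cU (Umat J) : ℝ) * (√π / (1.7725 + 1 / 100) * (200 * (J.rn : ℝ) * βden / ((J.rd : ℝ) * βnum * sqrtUp J.n))) :=
        mul_le_mul_of_nonneg_left hK hc.le
    _ = √π / (1.7725 + 1 / 100) * (200 * (cU (Umat J) : ℝ) * J.rn * βden / ((J.rd : ℝ) * βnum * sqrtUp J.n)) := by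
        field_simp

/-! ### The grid against `q` -/

/-- **`q n 2ⁿ < N`.** [folklore] -/
theorem q_mul_lt_NOf_sharp (hJ : J.WellFormed) {q βnum βden : ℕ} (hβnum : 1 ≤ βnum) (hβden : 1 ≤ βden) {α : ℤ} (hα : α ≠ 0) (hrn : 1 ≤ J.rn) :
    q * J.n * 2 ^ J.n < NOf J α (N1Sharp J q βnum βden α) := by
  have hc := cR_pos hJ
  have hrd : (0 : ℝ) < J.rd := by exact_mod_cast hJ.rd_pos
  have hsq : (0 : ℝ) < sqrtUp J.n := by exact_mod_cast one_le_sqrtUp J.n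
  have hβn : (0 : ℝ) < βnum := by exact_mod_cast hβnum
  have hβd : (0 : ℝ) < βden := by exact_mod_cast hβden
  have hrn' : (0 : ℝ) < J.rn := by exact_mod_cast hrn
  have htd : (1 : ℝ) ≤ J.td := by exact_mod_cast hJ.td_pos
  have hαr : (1 : ℝ) ≤ (α.natAbs : ℝ) := by exact_mod_cast Int.natAbs_pos.2 hα
  have hs₁ := s1_pos hJ hβnum hβden hrn
  set s₁ : ℝ := 200 * (cU (Umat J) : ℝ) * J.rn * βden / ((J.rd : ℝ) * βnum * sqrtUp J.n) with hs₁def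
  set M : ℝ := (α.natAbs : ℝ) * J.td with hM
  have hM1 : 1 ≤ M := by rw [hM]; nlinarith
  obtain ⟨hy, hAB⟩ := ySharp_eq_and_lt hJ hβnum hβden hα hrn (q := q)
  have hN1 := (ySharp_lt_N1Sharp (J := J) q βnum βden α).1
  -- `2ᵇ > 100 s₁ M · (Q + 1)`, `Q = q n 2ⁿ`
  set Q : ℕ := q * J.n * 2 ^ J.n with hQ
  have hlt : (((AOf J βden α / BdOf J βnum + 1) * (Q + 1) : ℕ) : ℝ) < (2 : ℝ) ^ bSharp J q βnum βden α := by
    exact_mod_cast two_pow_bSharp_gt (J := J) q βnum βden α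
  have h2b : 100 * s₁ * M * ((Q : ℝ) + 1) < (2 : ℝ) ^ bSharp J q βnum βden α := by
    refine lt_of_le_of_lt ?_ hlt
    have hAB' := hAB.le
    push_cast at hAB' ⊢
    have hQ0 : (0 : ℝ) ≤ (Q : ℝ) + 1 := by positivity
    exact mul_le_mul_of_nonneg_right hAB' hQ0
  -- `N = N₁ M > y M = 2ᵇ · 1.7725/s₁ > 100 M (Q + 1) ≥ Q + 1`
  have hNcast : ((NOf J α (N1Sharp J q βnum βden α) : ℕ) : ℝ) = (N1Sharp J q βnum βden α : ℝ) * M := by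
    rw [NOf, hM]; push_cast; ring
  have hyM : ySharp J q βnum βden α * M = (2 : ℝ) ^ bSharp J q βnum βden α * (17725 / 10000) / s₁ := by
    rw [hy, hs₁def, hM]; field_simp
  have hgoal : (Q : ℝ) < ((NOf J α (N1Sharp J q βnum βden α) : ℕ) : ℝ) := by
    rw [hNcast]
    have h1 : ySharp J q βnum βden α * M < (N1Sharp J q βnum βden α : ℝ) * M := mul_lt_mul_of_pos_right hN1 (by positivity)
    refine lt_trans ?_ h1
    rw [hyM, lt_div_iff₀ hs₁]
    have hQ0 : (0 : ℝ) ≤ (Q : ℝ) := Nat.cast_nonneg _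
    nlinarith
  exact_mod_cast hgoal

/-- **`q ≤ N`.** [folklore] -/
theorem q_le_NOf_sharp (hJ : J.WellFormed) {q βnum βden : ℕ} (hβnum : 1 ≤ βnum) (hβden : 1 ≤ βden) {α : ℤ} (hα : α ≠ 0) (hrn : 1 ≤ J.rn) :
    q ≤ NOf J α (N1Sharp J q βnum βden α) := by
  have h := q_mul_lt_NOf_sharp hJ hβnum hβden hα hrn (q := q)
  have hn := hJ.one_le_n
  have : q ≤ q * J.n * 2 ^ J.n := by
    calc q = q * 1 * 1 := by ring
      _ ≤ q * J.n * 2 ^ J.n := Nat.mul_le_mul (Nat.mul_le_mul_left _ hn) Nat.one_le_two_pow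
  omega

/-- **`n q/N ≤ 2⁻ⁿ`.** [folklore] -/
theorem slackN_le_sharp (hJ : J.WellFormed) {q βnum βden : ℕ} (hβnum : 1 ≤ βnum) (hβden : 1 ≤ βden) {α : ℤ} (hα : α ≠ 0) (hrn : 1 ≤ J.rn) :
    (J.n : ℝ) * ((q : ℝ) / NOf J α (N1Sharp J q βnum βden α)) ≤ (2⁻¹ : ℝ) ^ J.n := by
  have h := q_mul_lt_NOf_sharp hJ hβnum hβden hα hrn (q := q)
  have hN : (0 : ℝ) < ((NOf J α (N1Sharp J q βnum βden α) : ℕ) : ℝ) := by exact_mod_cast NOf_pos hJ hα (N1Sharp_pos q βnum βden α)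
  have h' : ((q * J.n * 2 ^ J.n : ℕ) : ℝ) ≤ ((NOf J α (N1Sharp J q βnum βden α) : ℕ) : ℝ) := by exact_mod_cast h.le
  push_cast at h'
  rw [← mul_div_assoc, div_le_iff₀ hN, inv_pow, inv_mul_eq_div, le_div_iff₀ (by positivity)]
  linarith

/-- **`N · s = 2ᵇ√π`**, the width of the coin-driven sampler `std · b`. [folklore] -/
theorem NOf_mul_sSharp (hJ : J.WellFormed) (q βnum βden : ℕ) {α : ℤ} (hα : α ≠ 0) :
    (NOf J α (N1Sharp J q βnum βden α) : ℝ) * sSharp J q βnum βden α = (2 : ℝ) ^ bSharp J q βnum βden α * √π := by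
  have hN : ((NOf J α (N1Sharp J q βnum βden α) : ℕ) : ℝ) ≠ 0 := by exact_mod_cast (NOf_pos hJ hα (N1Sharp_pos q βnum βden α)).ne'
  rw [sSharp]; field_simp

end MRThm59

end Literature.Algebra.EuclideanLattices

end
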